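import Summits.KontsevichZagierPeriods.KontsevichZagierPeriods.Theorems.FurushoPentagonPentagonInKZRegEndCons
import Literature.NumberTheory.Transcendental.DrinfeldAssociatorRegularisation
import Literature.NumberTheory.Transcendental.Associators

/-!
# `PentagonInKZ`, line `edge-normal-newton-leibniz`: corner engine — peeling the outermost letter

Stub `cornerEngine_peel` of the crux `FurushoPentagon.PentagonInKZ`
(stmt-KontsevichZagierPeriods-11348).  Pure algebra, valid for all real parameters.

The corner engine pairs the residue monomials `wZ U = Z_{U₀} ⋯ Z_{U_{k-1}} ∈ DK_N(ℚ)` of a word `U`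
with the end-regularised word integrands `Ht U x ξ η = Σ_u ⟨regEnd₀ U, u⟩ · qH u x ξ η` (IKZ end
regularisation `Shuffle.regEnd`, dilated cubical integrands `qH`).  Peeling the OUTERMOST letter
`a = u₀` of the integration word and the outermost cubical variable `x₀`:

* the cubical integrand factorises, `qH (a u') (x₀ x') ξ η = h_a(x₀) · qH u' x' (ξ x₀) η` with
  `h_a(x₀) = [a = 0 ? 1/x₀ : ξ · fd a (ξ x₀) η]` (`CornerEnginePeel.prod_peel`);
* the regularised coefficient obeys the first lead's first-letter stripping rule
  `⟨regEnd₀ U, a u'⟩ = [U = a U'] ⟨regEnd₀ U', u'⟩ − [a = 0] [U = U' 0] ⟨regEnd₀ U', u'⟩`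
  (`regEnd_apply_cons`);
* resumming over `U = a U'` resp. `U = U' 0` and using `wZ (a U') = Z_a · wZ U'`,
  `wZ (U' 0) = wZ U' · Z₀` gives the registered identity
  `Σ_U μ(wZ U) Ht U (x₀ x') ξ η = Σ_a h_a(x₀) Σ_{U'} μ(Z_a wZ U') Ht U' x' (ξx₀) η
     − x₀⁻¹ Σ_{U'} μ(wZ U' Z₀) Ht U' x' (ξx₀) η`
  (`CornerEnginePeel.peel`, the abstract resummation), and its mirror image for the vertical side
  (letter `1`, `qV`, `Vt`, `gd`, `y₀`).

References: K. Ihara, M. Kaneko, D. Zagier, Compos. Math. 142 (2006), §3, Cor. 5 (the transport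
equation of end-regularised iterated integrals); V. G. Drinfeld, Leningrad Math. J. 2 (1991), §2.
-/

noncomputable section

open scoped BigOperators
open Literature.NumberTheory.Transcendental

namespace Summit.KontsevichZagierPeriods.FurushoPentagon.PentagonInKZ

namespace CornerEnginePeel

variable {L : Type} [Fintype L]

/-! ### Splitting sums over `(k+1)`-tuples -/

/-- `Σ_{u : Fin (k+1) → L} f u = Σ_a Σ_{u'} f (a u')` (split off the first letter). [folklore] -/
theorem sum_eq_sum_cons {M : Type*} [AddCommMonoid M] {k : ℕ} (f : (Fin (k + 1) → L) → M) :
    ∑ u, f u = ∑ a : L, ∑ u' : Fin k → L, f (Fin.cons a u') := by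
  rw [← (Fin.consEquiv fun _ => L).sum_comp f, Fintype.sum_prod_type]
  rfl

/-- `Σ_{u : Fin (k+1) → L} f u = Σ_{u'} Σ_b f (u' b)` (split off the last letter). [folklore] -/
theorem sum_eq_sum_snoc {M : Type*} [AddCommMonoid M] {k : ℕ} (f : (Fin (k + 1) → L) → M) :
    ∑ u, f u = ∑ u' : Fin k → L, ∑ b : L, f (Fin.snoc u' b) := by
  rw [← (Fin.snocEquiv fun _ => L).sum_comp f, Fintype.sum_prod_type_right]
  rfl

/-! ### `List.ofFn` of `Fin.cons` / `Fin.snoc` -/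

omit [Fintype L] in
/-- `ofFn (u' b) = ofFn u' ++ [b]`. [folklore] -/
theorem ofFn_snoc {k : ℕ} (u' : Fin k → L) (b : L) :
    List.ofFn (Fin.snoc u' b : Fin (k + 1) → L) = List.ofFn u' ++ [b] := by
  rw [List.ofFn_succ_last]
  simp only [Fin.snoc_castSucc, Fin.snoc_last]

omit [Fintype L] in
/-- The residue monomial of `a U'`: `wZ (a U') = Z_a · wZ U'`. [folklore] -/
theorem prod_map_ofFn_cons {A : Type*} [Monoid A] (Z : L → A) {k : ℕ} (a : L)
    (U' : Fin k → L) :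
    ((List.ofFn (Fin.cons a U' : Fin (k + 1) → L)).map Z).prod
      = Z a * ((List.ofFn U').map Z).prod := by
  rw [List.ofFn_cons, List.map_cons, List.prod_cons]

omit [Fintype L] in
/-- The residue monomial of `U' b`: `wZ (U' b) = wZ U' · Z_b`. [folklore] -/
theorem prod_map_ofFn_snoc {A : Type*} [Monoid A] (Z : L → A) {k : ℕ} (U' : Fin k → L)
    (b : L) :
    ((List.ofFn (Fin.snoc U' b : Fin (k + 1) → L)).map Z).prod
      = ((List.ofFn U').map Z).prod * Z b := by
  rw [ofFn_snoc, List.map_append, List.prod_append, List.map_singleton, List.prod_singleton]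

/-! ### Factorisation of the dilated cubical integrand -/

/-- `∏_{j < 0} x_j = 1` on `Fin (k+1)`. [folklore] -/
theorem prod_filter_lt_zero {k : ℕ} (x : Fin (k + 1) → ℝ) :
    ∏ j ∈ Finset.univ.filter (fun j : Fin (k + 1) => j < 0), x j = 1 := by
  rw [Finset.prod_filter, Finset.prod_eq_one]
  intro j _
  rw [if_neg (Fin.not_lt_zero j)]

/-- `∏_{j ≤ 0} x_j = x₀` on `Fin (k+1)`. [folklore] -/
theorem prod_filter_le_zero {k : ℕ} (x : Fin (k + 1) → ℝ) :
    ∏ j ∈ Finset.univ.filter (fun j : Fin (k + 1) => j ≤ 0), x j = x 0 := by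
  rw [Finset.prod_filter, Fin.prod_univ_succ, if_pos le_rfl, Finset.prod_eq_one, mul_one]
  intro j _
  rw [if_neg (not_le.mpr (Fin.succ_pos j))]

/-- `∏_{j < i+1} (x₀ x')_j = x₀ ∏_{j < i} x'_j`. [folklore] -/
theorem prod_filter_lt_succ {k : ℕ} (x₀ : ℝ) (x' : Fin k → ℝ) (i : Fin k) :
    ∏ j ∈ Finset.univ.filter (fun j : Fin (k + 1) => j < i.succ), (Fin.cons x₀ x' : Fin (k + 1) → ℝ) j
      = x₀ * ∏ j ∈ Finset.univ.filter (fun j : Fin k => j < i), x' j := by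
  rw [Finset.prod_filter, Finset.prod_filter, Fin.prod_univ_succ, if_pos (Fin.succ_pos i),
    Fin.cons_zero]
  simp only [Fin.cons_succ, Fin.succ_lt_succ_iff]

/-- `∏_{j ≤ i+1} (x₀ x')_j = x₀ ∏_{j ≤ i} x'_j`. [folklore] -/
theorem prod_filter_le_succ {k : ℕ} (x₀ : ℝ) (x' : Fin k → ℝ) (i : Fin k) :
    ∏ j ∈ Finset.univ.filter (fun j : Fin (k + 1) => j ≤ i.succ), (Fin.cons x₀ x' : Fin (k + 1) → ℝ) j
      = x₀ * ∏ j ∈ Finset.univ.filter (fun j : Fin k => j ≤ i), x' j := by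
  rw [Finset.prod_filter, Finset.prod_filter, Fin.prod_univ_succ, if_pos (Fin.succ_pos i).le,
    Fin.cons_zero]
  simp only [Fin.cons_succ, Fin.succ_le_succ_iff]

omit [Fintype L] in
/-- **Factorisation of the dilated cubical word integrand** when the outermost letter `a` and the
outermost variable `x₀` are split off:
`q (a u') (x₀ x') s = [a = c ? 1/x₀ : s φ_a(s x₀)] · q u' x' (s x₀)`. [folklore] -/
theorem prod_peel [DecidableEq L] (c : L) (φ : L → ℝ → ℝ) {k : ℕ} (a : L) (u' : Fin k → L)
    (x₀ s : ℝ) (x' : Fin k → ℝ) :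
    (∏ i : Fin (k + 1), if (Fin.cons a u' : Fin (k + 1) → L) i = c
        then 1 / (Fin.cons x₀ x' : Fin (k + 1) → ℝ) i
        else (s * ∏ j ∈ Finset.univ.filter (fun j => j < i), (Fin.cons x₀ x' : Fin (k + 1) → ℝ) j) *
          φ ((Fin.cons a u' : Fin (k + 1) → L) i)
            (s * ∏ j ∈ Finset.univ.filter (fun j => j ≤ i), (Fin.cons x₀ x' : Fin (k + 1) → ℝ) j))
      = (if a = c then 1 / x₀ else s * φ a (s * x₀)) *
        ∏ i : Fin k, if u' i = c then 1 / x' i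
          else ((s * x₀) * ∏ j ∈ Finset.univ.filter (fun j => j < i), x' j) *
            φ (u' i) ((s * x₀) * ∏ j ∈ Finset.univ.filter (fun j => j ≤ i), x' j) := by
  rw [Fin.prod_univ_succ]
  simp only [Fin.cons_zero, Fin.cons_succ, prod_filter_lt_zero, prod_filter_le_zero,
    prod_filter_lt_succ, prod_filter_le_succ, mul_one, mul_assoc]

/-! ### The abstract resummation -/

variable [DecidableEq L]

/-- **Peeling the outermost letter** (abstract form).  For a "big" integrand `Q` on `(k+1)`-words
factorising through a "small" one `Q'` (`Q (a u') = h a · Q' u'`) and weights `W` with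
`W (a U') = Wl a U'`, `W (U' c) = Wr U'`, the first-letter stripping rule of the end
regularisation (`regEnd_apply_cons`) resums to
`Σ_U W U Σ_u ⟨regEnd_c U, u⟩ Q u = Σ_a h a Σ_{U'} Wl a U' Σ_{u'} ⟨regEnd_c U', u'⟩ Q' u'
   − h c Σ_{U'} Wr U' Σ_{u'} ⟨regEnd_c U', u'⟩ Q' u'`.
[cite: IharaKanekoZagier2006, Cor. 5 (mirror image)] -/
theorem peel (c : L) {k : ℕ} (Q : (Fin (k + 1) → L) → ℝ) (Q' : (Fin k → L) → ℝ) (h : L → ℝ)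
    (hQ : ∀ a u', Q (Fin.cons a u') = h a * Q' u')
    (W : (Fin (k + 1) → L) → ℝ) (Wl : L → (Fin k → L) → ℝ) (Wr : (Fin k → L) → ℝ)
    (hWl : ∀ a U', W (Fin.cons a U') = Wl a U') (hWr : ∀ U', W (Fin.snoc U' c) = Wr U') :
    ∑ U, W U * ∑ u, (Shuffle.regEnd c (List.ofFn U) (List.ofFn u) : ℝ) * Q u
      = (∑ a, h a * ∑ U', Wl a U' *
            ∑ u', (Shuffle.regEnd c (List.ofFn U') (List.ofFn u') : ℝ) * Q' u')
        - h c * ∑ U', Wr U' * ∑ u', (Shuffle.regEnd c (List.ofFn U') (List.ofFn u') : ℝ) * Q' u' := by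
  -- Step 1: split `u = a u'`, factorise `Q`, strip the first letter through `regEnd`
  have hinner : ∀ U : Fin (k + 1) → L,
      ∑ u, (Shuffle.regEnd c (List.ofFn U) (List.ofFn u) : ℝ) * Q u =
        (∑ a, ∑ u', ((if (List.ofFn U).head? = some a
            then Shuffle.regEnd c (List.ofFn U).tail (List.ofFn u') else 0 : ℚ) : ℝ) *
              (h a * Q' u')) -
        ∑ a, ∑ u', ((if a = c ∧ (List.ofFn U).getLast? = some c
            then Shuffle.regEnd c (List.ofFn U).dropLast (List.ofFn u') else 0 : ℚ) : ℝ) *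
              (h a * Q' u') := by
    intro U
    rw [sum_eq_sum_cons, ← Finset.sum_sub_distrib]
    refine Finset.sum_congr rfl fun a _ => ?_
    rw [← Finset.sum_sub_distrib]
    refine Finset.sum_congr rfl fun u' _ => ?_
    rw [List.ofFn_cons, regEnd_apply_cons, hQ, Rat.cast_sub, sub_mul]
  simp_rw [hinner, mul_sub, Finset.sum_sub_distrib]
  congr 1
  · -- Step 2a: resum over `U = a₀ U'`
    rw [sum_eq_sum_cons]
    refine Finset.sum_congr rfl fun a₀ _ => ?_
    rw [Finset.mul_sum]
    refine Finset.sum_congr rfl fun U' _ => ?_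
    have hhead : (List.ofFn (Fin.cons a₀ U' : Fin (k + 1) → L)).head? = some a₀ := by
      rw [List.ofFn_cons, List.head?_cons]
    have htail : (List.ofFn (Fin.cons a₀ U' : Fin (k + 1) → L)).tail = List.ofFn U' := by
      rw [List.ofFn_cons, List.tail_cons]
    simp only [hhead, htail, Option.some.injEq, hWl]
    rw [Finset.sum_eq_single a₀ (fun a _ ha => ?_) (fun ha => absurd (Finset.mem_univ a₀) ha)]
    · simp only [if_true, Finset.mul_sum]
      refine Finset.sum_congr rfl fun u' _ => ?_
      ring
    · simp only [if_neg (Ne.symm ha), Rat.cast_zero, zero_mul, Finset.sum_const_zero]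
  · -- Step 2b: resum over `U = U' b`
    rw [sum_eq_sum_snoc, Finset.mul_sum]
    refine Finset.sum_congr rfl fun U' _ => ?_
    have hlast : ∀ b : L, (List.ofFn (Fin.snoc U' b : Fin (k + 1) → L)).getLast? = some b := by
      intro b; rw [ofFn_snoc, List.getLast?_concat]
    have hdrop : ∀ b : L, (List.ofFn (Fin.snoc U' b : Fin (k + 1) → L)).dropLast = List.ofFn U' := by
      intro b; rw [ofFn_snoc, List.dropLast_concat]
    simp only [hlast, hdrop, Option.some.injEq]
    rw [Finset.sum_eq_single c (fun b _ hb => ?_) (fun hc => absurd (Finset.mem_univ c) hc)]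
    · rw [hWr, Finset.sum_eq_single c (fun a _ ha => ?_) (fun hc => absurd (Finset.mem_univ c) hc)]
      · simp only [and_self, if_true, Finset.mul_sum]
        refine Finset.sum_congr rfl fun u' _ => ?_
        ring
      · simp only [ha, false_and, if_false, Rat.cast_zero, zero_mul, Finset.sum_const_zero]
    · simp only [hb, and_false, if_false, Rat.cast_zero, zero_mul, Finset.sum_const_zero,
        mul_zero]

end CornerEnginePeel

open CornerEnginePeel in
/-- **Stub `cornerEngine_peel`** — peeling the outermost letter of the regularised word integrands
of the corner engine.  With the dictionary of the engine (letter densities `fd`, `gd`, dilated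
cubical word integrands `qH`, `qV`, end-regularised integrands `Ht = Σ_u ⟨regEnd₀ U, u⟩ qH u`,
`Vt = Σ_v ⟨regEnd₁ V, v⟩ qV v`, residue monomials `wZ U = Z_{U₀} ⋯ Z_{U_{k-1}}`), for every
`ℚ`-linear functional `μ` on `DK_N(ℚ)`:
`Σ_U μ(wZ U) Ht U (x₀ x') ξ η = Σ_a [a = 0 ? 1/x₀ : ξ fd a (ξx₀) η] Σ_{U'} μ(Z_a wZ U') Ht U' x' (ξx₀) η
   − x₀⁻¹ Σ_{U'} μ(wZ U' Z₀) Ht U' x' (ξx₀) η`,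
and the mirror statement for the vertical side.  The cubical integrand factorises when the
outermost variable is split off (`CornerEnginePeel.prod_peel`), the regularised coefficients obey
the first-letter stripping rule `regEnd_apply_cons` (IKZ's transport equation for end-regularised
iterated integrals), and the two resulting sums are resummed over `U = a U'` resp. `U = U' 0`
(`CornerEnginePeel.peel`). [cite: IharaKanekoZagier2006, Cor. 5] -/
theorem cornerEngine_peel :
    ∀ (m : ℕ) (cf : Fin (m + 2) → Fin 4 → ℚ) (N : ℕ) (nZ : Fin (m + 2) → Fin 4 → Fin 4 → ℤ) (fd : Fin (m + 2) → ℝ → ℝ → ℝ) (hfd : ∀ k t y, fd k t y = ((cf k 1 : ℝ) + (cf k 3 : ℝ) * y) / ((cf k 0 : ℝ) + (cf k 1 : ℝ) * t + (cf k 2 : ℝ) * y + (cf k 3 : ℝ) * t * y)) (gd : Fin (m + 2) → ℝ → ℝ → ℝ) (hgd : ∀ k x s, gd k x s = ((cf k 2 : ℝ) + (cf k 3 : ℝ) * x) / ((cf k 0 : ℝ) + (cf k 1 : ℝ) * x + (cf k 2 : ℝ) * s + (cf k 3 : ℝ) * x * s)) (qH : ∀ {n : ℕ}, (Fin n → Fin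 (m + 2)) → (Fin n → ℝ) → ℝ → ℝ → ℝ) (hqH : ∀ {n : ℕ} (u : Fin n → Fin (m + 2)) (x : Fin n → ℝ) (ξ η : ℝ), qH u x ξ η = ∏ i, if u i = 0 then 1 / x i else (ξ * ∏ j ∈ Finset.univ.filter (fun j => j < i), x j) * fd (u i) (ξ * ∏ j ∈ Finset.univ.filter (fun j => j ≤ i), x j) η) (qV : ∀ {n : ℕ}, (Fin n → Fin (m + 2)) → (Fin n → ℝ) → ℝ → ℝ → ℝ) (hqV : ∀ {n : ℕ} (v : Fin n → Fin (m + 2)) (y : Fin n → ℝ) (ξ η : ℝ), qV v y ξ η = ∏ i, if v i = 1 then 1 / y i else (η * ∏ j ∈ Finset.univ.filter (fun j => j < i), y j) * gd (v i) ξ (η * ∏ j ∈ Finset.univ.filter (fun j => j ≤ i), y j)) (Ht : ∀ {n : ℕ}, (Fin n → Fin (m + 2)) → (Fin n → ℝ) → ℝ → ℝ → ℝ) (hHt : ∀ {n : ℕ} (U : Fin n → Fin (m + 2)) (x : Fin n → ℝ) (ξ η : ℝ), Ht U x ξ η = ∑ u : Fin n → Fin (m + 2), (Shuffle.regEnd (0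 : Fin (m + 2)) (List.ofFn U) (List.ofFn u) : ℝ) * qH u x ξ η) (Vt : ∀ {n : ℕ}, (Fin n → Fin (m + 2)) → (Fin n → ℝ) → ℝ → ℝ → ℝ) (hVt : ∀ {n : ℕ} (V : Fin n → Fin (m + 2)) (y : Fin n → ℝ) (ξ η : ℝ), Vt V y ξ η = ∑ v : Fin n → Fin (m + 2), (Shuffle.regEnd (1 : Fin (m + 2)) (List.ofFn V) (List.ofFn v) : ℝ) * qV v y ξ η) (wZ : ∀ {n : ℕ}, (Fin n → Fin (m + 2)) → DrinfeldKohnoTrunc ℚ (Fin 4) N) (hwZ : ∀ {n : ℕ} (U : Fin n → Fin (m + 2)), wZ U = ((List.ofFn U).map fun k => ∑ i : Fin 4, ∑ j : Fin 4, (nZ k i j : ℚ) • DrinfeldKohnoTrunc.t ℚ N i j).prod), (∀ (μ : DrinfeldKohnoTrunc ℚ (Fin 4) N →ₗ[ℚ] ℚ) {k : ℕ} (x₀ : ℝ) (x' : Fin k → ℝ) (ξ η : ℝ), ∑ U : Fin (k + 1) → Fin (m + 2), (μ (wZ U) : ℝ) * Ht U (Fin.cons x₀ x') ξ η = (∑ a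 : Fin (m + 2), (if a = 0 then 1 / x₀ else ξ * fd a (ξ * x₀) η) * ∑ U' : Fin k → Fin (m + 2), (μ ((∑ i : Fin 4, ∑ j : Fin 4, (nZ a i j : ℚ) • DrinfeldKohnoTrunc.t ℚ N i j) * wZ U') : ℝ) * Ht U' x' (ξ * x₀) η) - (1 / x₀) * ∑ U' : Fin k → Fin (m + 2), (μ (wZ U' * (∑ i : Fin 4, ∑ j : Fin 4, (nZ 0 i j : ℚ) • DrinfeldKohnoTrunc.t ℚ N i j)) : ℝ) * Ht U' x' (ξ * x₀) η) ∧ (∀ (μ : DrinfeldKohnoTrunc ℚ (Fin 4) N →ₗ[ℚ] ℚ) {l : ℕ} (y₀ : ℝ) (y' : Fin l → ℝ) (ξ η : ℝ), ∑ V : Fin (l + 1) → Fin (m + 2), (μ (wZ V) : ℝ) * Vt V (Fin.cons y₀ y') ξ η = (∑ b : Fin (m + 2), (if b = 1 then 1 / y₀ else η * gd b ξ (η * y₀)) * ∑ V' : Fin l → Fin (m + 2), (μ ((∑ i : Fin 4, ∑ j : Fin 4, (nZ b i j : ℚ) • DrinfeldKohnoTrunc.t ℚ N i j) * wZ V') :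 ℝ) * Vt V' y' ξ (η * y₀)) - (1 / y₀) * ∑ V' : Fin l → Fin (m + 2), (μ (wZ V' * (∑ i : Fin 4, ∑ j : Fin 4, (nZ 1 i j : ℚ) • DrinfeldKohnoTrunc.t ℚ N i j)) : ℝ) * Vt V' y' ξ (η * y₀)) := by
  intro m cf N nZ fd _ gd _ qH hqH qV hqV Ht hHt Vt hVt wZ hwZ
  -- the residue letters `Z_a = Σ_{ij} nZ a i j • t_ij`
  set Z : Fin (m + 2) → DrinfeldKohnoTrunc ℚ (Fin 4) N :=
    fun a => ∑ i : Fin 4, ∑ j : Fin 4, (nZ a i j : ℚ) • DrinfeldKohnoTrunc.t ℚ N i j with hZ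
  have hwZ_cons : ∀ {k : ℕ} (a : Fin (m + 2)) (U' : Fin k → Fin (m + 2)),
      wZ (Fin.cons a U') = Z a * wZ U' := fun a U' => by
    rw [hwZ, hwZ, prod_map_ofFn_cons]
  have hwZ_snoc : ∀ {k : ℕ} (U' : Fin k → Fin (m + 2)) (b : Fin (m + 2)),
      wZ (Fin.snoc U' b) = wZ U' * Z b := fun U' b => by
    rw [hwZ, hwZ, prod_map_ofFn_snoc]
  refine ⟨fun μ k x₀ x' ξ η => ?_, fun μ l y₀ y' ξ η => ?_⟩
  · have key := peel (0 : Fin (m + 2)) (fun u => qH u (Fin.cons x₀ x') ξ η)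
      (fun u' => qH u' x' (ξ * x₀) η) (fun a => if a = 0 then 1 / x₀ else ξ * fd a (ξ * x₀) η)
      (fun a u' => by rw [hqH, hqH]; exact prod_peel 0 (fun a t => fd a t η) a u' x₀ ξ x')
      (fun U => (μ (wZ U) : ℝ)) (fun a U' => (μ (Z a * wZ U') : ℝ)) (fun U' => (μ (wZ U' * Z 0) : ℝ))
      (fun a U' => by rw [hwZ_cons]) (fun U' => by rw [hwZ_snoc])
    simp only [if_true] at key
    simp only [hHt]
    exact key
  · have key := peel (1 : Fin (m + 2)) (fun v => qV v (Fin.cons y₀ y') ξ η)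
      (fun v' => qV v' y' ξ (η * y₀)) (fun b => if b = 1 then 1 / y₀ else η * gd b ξ (η * y₀))
      (fun b v' => by rw [hqV, hqV]; exact prod_peel 1 (fun b t => gd b ξ t) b v' y₀ η y')
      (fun V => (μ (wZ V) : ℝ)) (fun b V' => (μ (Z b * wZ V') : ℝ)) (fun V' => (μ (wZ V' * Z 1) : ℝ))
      (fun b V' => by rw [hwZ_cons]) (fun V' => by rw [hwZ_snoc])
    simp only [if_true] at key
    simp only [hVt]
    exact key

end Summit.KontsevichZagierPeriods.FurushoPentagon.PentagonInKZ
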